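import Summits.QuantumFields.YangMills.Theorems.SwapVirialDeficitBlowUpGnomonicFibreRescaled
import Summits.QuantumFields.YangMills.Theorems.SwapVirialDeficitBlowUpGnomonicAnisoCoercivity
import Summits.QuantumFields.YangMills.Theorems.SwapVirialDeficitSectorLaplaceBulkFibredBox
import HarnessLib

/-!
# THE RESCALED FIBRE LETTERS: UNIFORM COERCIVITY AND UNIFORM FAR FLOOR over the whole base plane `ℝ²`
# (free-hands support of ⟨stmt-QuantumFields-24197⟩ `SwapVirialDeficit.SwapGluedStiffness` ∕ ⟨24194⟩; cell ym-idea-1, (S)-road option E1, stub S2∞ = S2 ∪ S5c)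

In the RESCALED fibre letters of ✓`gnoScale` (`y_x ↦ √(1+x₀²)·y_x`, `y_y ↦ √(1+y₀²)·y_y`, `z`, `η_F` unchanged; file ✓`…BlowUpGnomonicFibreRescaled`) the two
floors of the √b bulk law are UNIFORM in the base point `p = (x₀,y₀) ∈ ℝ²` at a bulk hub (`ψ₀ ≤ sin²2ψ`, `ψ₀ ≤ sin²ψ`, `0 < ψ₀ ≤ 1`):
* §1 algebra of the rescaling: `prod_gnoFibreScale` (Jacobian `(1+x₀²)(1+y₀²)`), `gnoScaleLin_isSymmetric`, `gnoFibreBlocks_gnoScale`, `gnoFibreEquiv_gnoScale_eq_ray`;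
* §2 ★★ `fibQ_gnoScale_ge` — UNIFORM COERCIVITY `ψ₀∕(82944L¹⁰)·‖y‖² ≤ Q_{a,ε,p}(gnoScale p y)` from the diagonal part of w3 g66's anisotropic floor
  ✓`fibre_raySecond_ge_aniso` (its soft coefficients `sin²2ψ∕(1+x₀²)`, `sin²ψ∕(1+y₀²)` are exactly absorbed by the rescaling; the relative-rotation term is dropped);
  ★★ `farFloor_gnoScale` — UNIFORM FAR FLOOR `0 ≤ R ≤ 1, R ≤ ‖y‖ ⟹ ψ₀R²∕(82944L¹⁰) ≤ F̂(gnoFibreEquiv (p, gnoScale p y))` from ✓`hub_ray_minorant` ∕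
  ✓`follower_ray_minorant` at `s = 1` (`gnoWtr = 4|y_x|²∕(1+|y_x|²)` in rescaled letters — no `(2+x₀²)⁻¹` loss); the scalar cores `aniso_rescaled_arith`, `far_rescaled_arith`
  are stated over opaque reals (keeps `positivity` away from the `Σ_f` atoms).

HONEST LABEL: inequalities composed from landed files; the plane bulk estimate is two files on; S3∕S4∕S5, ⟨24197⟩ ∕ ⟨24194⟩ OPEN; own crux ⟨22884⟩
`LargeFieldMassRefinementTail` OPEN (blocked-on ⟨19935⟩); the Yang–Mills mass gap is NOT proved; no summit is proved by a line.  THEOREMS ONLY (0 `def`, 0 `sorry`,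
no instance), standard axioms.  Width seat ym-line-sfw-p2-w2 g59 (cell ym-idea-1, free hands), `--supports stmt-QuantumFields-24197`.  References: [cite: Luscher1983, §2]; [folklore].
-/

set_option autoImplicit false
set_option synthInstance.maxSize 1024

noncomputable section

open MeasureTheory Quaternion Set Metric Module
open scoped Quaternion BigOperators ENNReal InnerProductSpace
open Literature.MathematicalPhysics.QuantumLattice
open Literature.MathematicalPhysics.QuantumFieldTheory hiding SU2

namespace Summit.QuantumFields.YangMills.Theorems.SwapVirialDeficit.BlowUpRing

open Summit.QuantumFields.YangMills.Theorems.FemtoTransferGap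
open Summit.QuantumFields.YangMills.Theorems.FemtoTransferGap.TT
open Summit.QuantumFields.YangMills.Theorems.VirialFluxGap.RingDeficit
open Summit.QuantumFields.YangMills.Theorems.SwapVirialDeficit.SwapRing
open Summit.QuantumFields.YangMills.Theorems.SwapVirialDeficit.SectorLaplace (fibQ z₀)
open Summit.QuantumFields.YangMills.Theorems.SwapVirialDeficit.Gnomonic (normSq3 normSq3_nonneg)

variable {L : ℕ} [NeZero L]

/-! ## §1 Algebra of the rescaling -/

/-- The rescaling Jacobian: `Π_i c_i(p) = (1+x₀²)(1+y₀²)`. [folklore] -/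
theorem prod_gnoFibreScale (p : ℝ × ℝ) : ∏ i, gnoFibreScale (L := L) p i = (1 + p.1 ^ 2) * (1 + p.2 ^ 2) := by
  rw [Fintype.prod_sum_type, Fintype.prod_sum_type, Fintype.prod_sum_type]
  simp only [gnoFibreScale, Sum.elim_inl, Sum.elim_inr, Finset.prod_const, Finset.card_univ, Fintype.card_fin, one_pow, mul_one]
  have hx : Real.sqrt (1 + p.1 ^ 2) ^ 2 = 1 + p.1 ^ 2 := Real.sq_sqrt (by positivity)
  have hy : Real.sqrt (1 + p.2 ^ 2) ^ 2 = 1 + p.2 ^ 2 := Real.sq_sqrt (by positivity)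
  rw [hx, hy]

/-- The same with absolute values (all weights are positive). [folklore] -/
theorem prod_abs_gnoFibreScale (p : ℝ × ℝ) : ∏ i, |gnoFibreScale (L := L) p i| = (1 + p.1 ^ 2) * (1 + p.2 ^ 2) := by
  rw [← prod_gnoFibreScale (L := L) p]
  exact Finset.prod_congr rfl fun i _ => abs_of_pos (gnoFibreScale_pos p i)

/-- The Jacobian is positive. [folklore] -/
theorem prod_abs_gnoFibreScale_pos (p : ℝ × ℝ) : 0 < ∏ i, |gnoFibreScale (L := L) p i| := by
  rw [prod_abs_gnoFibreScale]; positivity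

/-- The rescaling is a symmetric (diagonal) operator of the Euclidean fibre. [folklore] -/
theorem gnoScaleLin_isSymmetric (p : ℝ × ℝ) : (gnoScaleLin (L := L) p).IsSymmetric := by
  intro x y
  show ⟪gnoScale p x, y⟫_ℝ = ⟪x, gnoScale p y⟫_ℝ
  simp only [PiLp.inner_apply, gnoScale_apply, RCLike.inner_apply, conj_trivial]
  exact Finset.sum_congr rfl fun i _ => by ring

omit [NeZero L] in
/-- `gnoScaleLin p y = gnoScale p y`. [folklore] -/
theorem gnoScaleLin_apply (p : ℝ × ℝ) (y : GnoFibre L) : gnoScaleLin p y = gnoScale p y := rfl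

omit [NeZero L] in
/-- The letter blocks of the rescaled vector: `u ↦ √(1+x₀²)·u`, `v ↦ √(1+y₀²)·v`, `z`, `η_F` unchanged. [folklore] -/
theorem gnoFibreBlocks_gnoScale (p : ℝ × ℝ) (y : GnoFibre L) :
    gnoFibreBlocks (gnoScale p y) = (((fun j => Real.sqrt (1 + p.1 ^ 2) * (gnoFibreBlocks y).1.1 j), (fun j => Real.sqrt (1 + p.2 ^ 2) * (gnoFibreBlocks y).1.2 j)),
      ((gnoFibreBlocks y).2.1, (gnoFibreBlocks y).2.2)) := by
  simp only [gnoFibreBlocks, gnoScale_apply, gnoFibreScale, Sum.elim_inl, Sum.elim_inr, one_mul]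

/-- The rescaled point in w3's ray letters: `gnoFibreEquiv (p, gnoScale p y) = η₀(x₀,y₀) + 1·ξ(w′)` with `w′` the rescaled blocks. [folklore] -/
theorem gnoFibreEquiv_gnoScale_eq_ray (p : ℝ × ℝ) (y : GnoFibre L) :
    gnoFibreEquiv (p, gnoScale p y) =
      ((((![p.1, 0, 0] : Fin 3 → ℝ), (![p.2, 0, 0] : Fin 3 → ℝ)), ((0 : Fin 3 → ℝ), (0 : Fol L → Fin 3 → ℝ))) : GnoCoord L) +
        (1 : ℝ) • ((((![0, Real.sqrt (1 + p.1 ^ 2) * (gnoFibreBlocks y).1.1 0, Real.sqrt (1 + p.1 ^ 2) * (gnoFibreBlocks y).1.1 1] : Fin 3 → ℝ),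
            (![0, Real.sqrt (1 + p.2 ^ 2) * (gnoFibreBlocks y).1.2 0, Real.sqrt (1 + p.2 ^ 2) * (gnoFibreBlocks y).1.2 1] : Fin 3 → ℝ)),
            ((gnoFibreBlocks y).2.1, (gnoFibreBlocks y).2.2)) : GnoCoord L) := by
  rw [one_smul, gnoFibreEquiv_apply, gnoFibreEmb_eq_fibreDir, gnoFibreBlocks_gnoScale]
  rfl

/-! ## §2 Uniform coercivity and the uniform far floor in the rescaled letters -/

/-- `0 < |Fol L| ≤ 6L⁴` and `1 ≤ L`, as reals. [folklore] -/
theorem card_fol_facts : 0 < (Fintype.card (Fol L) : ℝ) ∧ (Fintype.card (Fol L) : ℝ) ≤ 6 * (L : ℝ) ^ 4 ∧ (1 : ℝ) ≤ (L : ℝ) := by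
  have hL1 : 1 ≤ L := NeZero.one_le
  refine ⟨?_, card_fol_real_le (L := L), by exact_mod_cast hL1⟩
  have h : 0 < Fintype.card (Fol L) := by rw [card_fol]; have := Nat.one_le_pow 4 L hL1; omega
  exact_mod_cast h

/-- The scalar inequality behind ✓`fibQ_gnoScale_ge`: bulk stiffnesses `ψ₀ ≤ S₁, S₂`, `ψ₀ ≤ 1`, `|Fol L| ≤ 6L⁴` make `ψ₀∕(82944L¹⁰)·N` a floor of the diagonal part
of the anisotropic form in rescaled letters (the relative-rotation term `Rel ≥ 0` is dropped). [folklore] -/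
theorem aniso_rescaled_arith {ψ₀ S1 S2 u0 u1 v0 v1 Z F Rel ℓ card : ℝ} (hψ₀ : 0 < ψ₀) (hψ₁ : ψ₀ ≤ 1) (hS1 : ψ₀ ≤ S1) (hS2 : ψ₀ ≤ S2)
    (hZ : 0 ≤ Z) (hF : 0 ≤ F) (hRel : 0 ≤ Rel) (hℓ : 1 ≤ ℓ) (hcard0 : 0 < card) (hcard : card ≤ 6 * ℓ ^ 4) :
    ψ₀ / (82944 * ℓ ^ 10) * (u0 ^ 2 + u1 ^ 2 + (v0 ^ 2 + v1 ^ 2) + Z + F) ≤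
      2 / 3 * ((S1 * (4 * (u0 ^ 2 + u1 ^ 2)) + S2 * (4 * (v0 ^ 2 + v1 ^ 2)) + 4 * Z) / (16200 * ℓ ^ 6) + 2 * F / (2304 * ℓ ^ 6 * card) + Rel) := by
  have hℓ0 : 0 < ℓ := by linarith
  have hℓ6 : (1 : ℝ) ≤ ℓ ^ 6 := one_le_pow₀ hℓ
  have hℓ610 : ℓ ^ 6 ≤ ℓ ^ 10 := pow_le_pow_right₀ hℓ (by norm_num)
  have hU0 : 0 ≤ u0 ^ 2 + u1 ^ 2 := by positivity
  have hV0 : 0 ≤ v0 ^ 2 + v1 ^ 2 := by positivity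
  have hS1n : 0 ≤ S1 := hψ₀.le.trans hS1
  have hS2n : 0 ≤ S2 := hψ₀.le.trans hS2
  have hA : ψ₀ / (82944 * ℓ ^ 10) * (u0 ^ 2 + u1 ^ 2 + (v0 ^ 2 + v1 ^ 2) + Z) ≤
      2 / 3 * ((S1 * (4 * (u0 ^ 2 + u1 ^ 2)) + S2 * (4 * (v0 ^ 2 + v1 ^ 2)) + 4 * Z) / (16200 * ℓ ^ 6)) := by
    rw [div_mul_eq_mul_div, div_mul_div_comm, div_le_div_iff₀ (by positivity) (by positivity)]
    have h1 : ψ₀ * (u0 ^ 2 + u1 ^ 2) ≤ S1 * (u0 ^ 2 + u1 ^ 2) := mul_le_mul_of_nonneg_right hS1 hU0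
    have h2 : ψ₀ * (v0 ^ 2 + v1 ^ 2) ≤ S2 * (v0 ^ 2 + v1 ^ 2) := mul_le_mul_of_nonneg_right hS2 hV0
    have h3 : ψ₀ * Z ≤ 1 * Z := mul_le_mul_of_nonneg_right hψ₁ hZ
    have hX0 : 0 ≤ S1 * (u0 ^ 2 + u1 ^ 2) + S2 * (v0 ^ 2 + v1 ^ 2) + Z := by positivity
    calc ψ₀ * (u0 ^ 2 + u1 ^ 2 + (v0 ^ 2 + v1 ^ 2) + Z) * (3 * (16200 * ℓ ^ 6))
        = 48600 * ℓ ^ 6 * (ψ₀ * (u0 ^ 2 + u1 ^ 2) + ψ₀ * (v0 ^ 2 + v1 ^ 2) + ψ₀ * Z) := by ring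
      _ ≤ 48600 * ℓ ^ 6 * (S1 * (u0 ^ 2 + u1 ^ 2) + S2 * (v0 ^ 2 + v1 ^ 2) + Z) := by
          refine mul_le_mul_of_nonneg_left ?_ (by positivity); linarith
      _ ≤ 663552 * ℓ ^ 10 * (S1 * (u0 ^ 2 + u1 ^ 2) + S2 * (v0 ^ 2 + v1 ^ 2) + Z) := by
          refine mul_le_mul_of_nonneg_right ?_ hX0; nlinarith
      _ = 2 * (S1 * (4 * (u0 ^ 2 + u1 ^ 2)) + S2 * (4 * (v0 ^ 2 + v1 ^ 2)) + 4 * Z) * (82944 * ℓ ^ 10) := by ring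
  have hB : ψ₀ / (82944 * ℓ ^ 10) * F ≤ 2 / 3 * (2 * F / (2304 * ℓ ^ 6 * card)) := by
    rw [div_mul_eq_mul_div, div_mul_div_comm, div_le_div_iff₀ (by positivity) (by positivity)]
    have h3 : ψ₀ * F ≤ 1 * F := mul_le_mul_of_nonneg_right hψ₁ hF
    calc ψ₀ * F * (3 * (2304 * ℓ ^ 6 * card))
        ≤ 1 * F * (3 * (2304 * ℓ ^ 6 * (6 * ℓ ^ 4))) := by gcongr
      _ = 41472 * ℓ ^ 10 * F := by ring
      _ ≤ 331776 * ℓ ^ 10 * F := by nlinarith [mul_nonneg (by positivity : (0 : ℝ) ≤ ℓ ^ 10) hF]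
      _ = 2 * (2 * F) * (82944 * ℓ ^ 10) := by ring
  have e : ψ₀ / (82944 * ℓ ^ 10) * (u0 ^ 2 + u1 ^ 2 + (v0 ^ 2 + v1 ^ 2) + Z + F) =
      ψ₀ / (82944 * ℓ ^ 10) * (u0 ^ 2 + u1 ^ 2 + (v0 ^ 2 + v1 ^ 2) + Z) + ψ₀ / (82944 * ℓ ^ 10) * F := by ring
  have e2 : 2 / 3 * ((S1 * (4 * (u0 ^ 2 + u1 ^ 2)) + S2 * (4 * (v0 ^ 2 + v1 ^ 2)) + 4 * Z) / (16200 * ℓ ^ 6) + 2 * F / (2304 * ℓ ^ 6 * card) + Rel) =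
      2 / 3 * ((S1 * (4 * (u0 ^ 2 + u1 ^ 2)) + S2 * (4 * (v0 ^ 2 + v1 ^ 2)) + 4 * Z) / (16200 * ℓ ^ 6)) + 2 / 3 * (2 * F / (2304 * ℓ ^ 6 * card)) + 2 / 3 * Rel := by
    ring
  rw [e, e2]
  linarith [mul_nonneg (by norm_num : (0 : ℝ) ≤ 2 / 3) hRel]

/-- ★★ **UNIFORM COERCIVITY IN THE RESCALED LETTERS** (principal sector, good signs, bulk hub `ψ₀ ≤ sin²2ψ`, `ψ₀ ≤ sin²ψ`, `0 < ψ₀ ≤ 1`): for EVERY `p ∈ ℝ²` and `y`,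
`ψ₀∕(82944L¹⁰)·‖y‖² ≤ Q_{a,ε,p}(gnoScale p y)` — the diagonal part of ✓`fibre_raySecond_ge_aniso`, whose soft weights `(1+x₀²)⁻¹`, `(1+y₀²)⁻¹` the rescaling absorbs.
[cite: Luscher1983, §2] -/
theorem fibQ_gnoScale_ge {a : ℍ} (ha : a ≠ 0) (ε : GnoSign L) (hz : ε.2.1 = true) (hε : ε.2.2 = fun _ => true) {ψ₀ : ℝ} (hψ₀ : 0 < ψ₀) (hψ₁ : ψ₀ ≤ 1)
    (hS1 : ψ₀ ≤ (2 * (‖a‖⁻¹ * a.re) * (‖a‖⁻¹ * ‖a.im‖)) ^ 2) (hS2 : ψ₀ ≤ (‖a‖⁻¹ * ‖a.im‖) ^ 2) (p : ℝ × ℝ) (y : GnoFibre L) :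
    ψ₀ / (82944 * (L : ℝ) ^ 10) * ‖y‖ ^ 2 ≤ fibQ a ε p (gnoScale p y) := by
  obtain ⟨hcard0, hcard, hL1⟩ := card_fol_facts (L := L)
  -- everything `positivity` must see is settled BEFORE the large hypothesis `key` enters the context
  have hcx : Real.sqrt (1 + p.1 ^ 2) ^ 2 = 1 + p.1 ^ 2 := Real.sq_sqrt (by positivity)
  have hcy : Real.sqrt (1 + p.2 ^ 2) ^ 2 = 1 + p.2 ^ 2 := Real.sq_sqrt (by positivity)
  have hx0 : (1 : ℝ) + p.1 ^ 2 ≠ 0 := by positivity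
  have hy0 : (1 : ℝ) + p.2 ^ 2 ≠ 0 := by positivity
  have ex : 4 * ((Real.sqrt (1 + p.1 ^ 2) * (gnoFibreBlocks y).1.1 0) ^ 2 + (Real.sqrt (1 + p.1 ^ 2) * (gnoFibreBlocks y).1.1 1) ^ 2) / (1 + p.1 ^ 2) =
      4 * ((gnoFibreBlocks y).1.1 0 ^ 2 + (gnoFibreBlocks y).1.1 1 ^ 2) := by
    rw [mul_pow, mul_pow, hcx]; field_simp
  have ey : 4 * ((Real.sqrt (1 + p.2 ^ 2) * (gnoFibreBlocks y).1.2 0) ^ 2 + (Real.sqrt (1 + p.2 ^ 2) * (gnoFibreBlocks y).1.2 1) ^ 2) / (1 + p.2 ^ 2) =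
      4 * ((gnoFibreBlocks y).1.2 0 ^ 2 + (gnoFibreBlocks y).1.2 1 ^ 2) := by
    rw [mul_pow, mul_pow, hcy]; field_simp
  have eF : ∑ f, 2 * normSq3 ((gnoFibreBlocks y).2.2 f) = 2 * ∑ f, normSq3 ((gnoFibreBlocks y).2.2 f) := by rw [Finset.mul_sum]
  have hrel : 0 ≤ ((p.2 * (Real.sqrt (1 + p.1 ^ 2) * (gnoFibreBlocks y).1.1 0) - p.1 * (Real.sqrt (1 + p.2 ^ 2) * (gnoFibreBlocks y).1.2 0)) ^ 2 +
        (p.2 * (Real.sqrt (1 + p.1 ^ 2) * (gnoFibreBlocks y).1.1 1) - p.1 * (Real.sqrt (1 + p.2 ^ 2) * (gnoFibreBlocks y).1.2 1)) ^ 2) /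
        (450 * (L : ℝ) ^ 6 * ((1 + p.1 ^ 2) * (1 + p.2 ^ 2))) := by positivity
  have hZ0 : 0 ≤ normSq3 (gnoFibreBlocks y).2.1 := normSq3_nonneg _
  have hF0 : 0 ≤ ∑ f, normSq3 ((gnoFibreBlocks y).2.2 f) := Finset.sum_nonneg fun f _ => normSq3_nonneg _
  -- w3's anisotropic floor at the rescaled blocks
  have key := fibre_raySecond_ge_aniso ha ε hz hε p.1 p.2 (gnoFibreBlocks (gnoScale p y))
  have hQ : iteratedDeriv 2 (fun s : ℝ => gnoDeficit (fun _ => false) (fun _ => 1) a ε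
        (((((![p.1, 0, 0] : Fin 3 → ℝ), (![p.2, 0, 0] : Fin 3 → ℝ)), ((0 : Fin 3 → ℝ), (0 : Fol L → Fin 3 → ℝ))) : GnoCoord L) +
          s • ((((![0, (gnoFibreBlocks (gnoScale p y)).1.1 0, (gnoFibreBlocks (gnoScale p y)).1.1 1] : Fin 3 → ℝ),
            (![0, (gnoFibreBlocks (gnoScale p y)).1.2 0, (gnoFibreBlocks (gnoScale p y)).1.2 1] : Fin 3 → ℝ)),
            ((gnoFibreBlocks (gnoScale p y)).2.1, (gnoFibreBlocks (gnoScale p y)).2.2)) : GnoCoord L))) 0 = fibQ a ε p (gnoScale p y) := by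
    unfold fibQ
    rw [gnoFibreEmb_eq_fibreDir]
    rfl
  rw [hQ, gnoFibreBlocks_gnoScale] at key
  dsimp only at key
  rw [ex, ey, eF] at key
  rw [norm_sq_gnoFibre]
  exact (aniso_rescaled_arith hψ₀ hψ₁ hS1 hS2 hZ0 hF0 hrel hL1 hcard0 hcard).trans key
set_option maxHeartbeats 400000 in
/-- The scalar inequality behind ✓`farFloor_gnoScale`: the hub minorant `h1` and the follower minorant `h2` (both with the common denominator `1 + T`, `T = ‖y‖²`)
give `ψ₀R²∕(82944L¹⁰) ≤ F̂` once `0 ≤ R ≤ 1`, `R² ≤ T`. [folklore] -/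
theorem far_rescaled_arith {ψ₀ S1 S2 U V Z F T R ℓ card Fhat : ℝ} (hψ₀ : 0 < ψ₀) (hψ₁ : ψ₀ ≤ 1) (hS1 : ψ₀ ≤ S1) (hS2 : ψ₀ ≤ S2)
    (hU : 0 ≤ U) (hV : 0 ≤ V) (hZ : 0 ≤ Z) (hF : 0 ≤ F) (hT : T = U + V + Z + F) (hR0 : 0 ≤ R) (hR1 : R ≤ 1) (hRT : R ^ 2 ≤ T)
    (hℓ : 1 ≤ ℓ) (hcard0 : 0 < card) (hcard : card ≤ 6 * ℓ ^ 4)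
    (h1 : (S1 * (4 * U / (1 + U)) + S2 * (4 * V / (1 + V)) + 4 * Z / (1 + Z)) / (16200 * ℓ ^ 6) ≤ Fhat)
    (h2 : 2 * F / (1 + T) / (2304 * ℓ ^ 6 * card) ≤ Fhat) :
    ψ₀ / (82944 * ℓ ^ 10) * R ^ 2 ≤ Fhat := by
  have hℓ0 : 0 < ℓ := by linarith
  have hℓ6 : (1 : ℝ) ≤ ℓ ^ 6 := one_le_pow₀ hℓ
  have hℓ610 : ℓ ^ 6 ≤ ℓ ^ 10 := pow_le_pow_right₀ hℓ (by norm_num)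
  have hℓ10 : 0 < ℓ ^ 10 := by positivity
  have hT0 : 0 ≤ T := by rw [hT]; positivity
  have hS1n : 0 ≤ S1 := hψ₀.le.trans hS1
  have hS2n : 0 ≤ S2 := hψ₀.le.trans hS2
  have hUT : U ≤ T := by linarith
  have hVT : V ≤ T := by linarith
  have hZT : Z ≤ T := by linarith
  have hTx : 4 * U / (1 + T) ≤ 4 * U / (1 + U) := div_le_div_of_nonneg_left (by positivity) (by positivity) (by linarith)
  have hTy : 4 * V / (1 + T) ≤ 4 * V / (1 + V) := div_le_div_of_nonneg_left (by positivity) (by positivity) (by linarith)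
  have hTz : 4 * Z / (1 + T) ≤ 4 * Z / (1 + Z) := div_le_div_of_nonneg_left (by positivity) (by positivity) (by linarith)
  -- (A) the hub minorant: `X∕4050 ≤ F̂`, `X = ψ₀(U+V+Z)∕((1+T)ℓ¹⁰)`
  set X : ℝ := ψ₀ * (U + V + Z) / ((1 + T) * ℓ ^ 10) with hX
  have hX0 : 0 ≤ X := by positivity
  have hA : X / 4050 ≤ Fhat := by
    refine le_trans ?_ h1
    have hnum : ψ₀ * (4 * (U + V + Z) / (1 + T)) ≤ S1 * (4 * U / (1 + U)) + S2 * (4 * V / (1 + V)) + 4 * Z / (1 + Z) := by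
      have g1 : ψ₀ * (4 * U / (1 + T)) ≤ S1 * (4 * U / (1 + U)) := mul_le_mul hS1 hTx (by positivity) hS1n
      have g2 : ψ₀ * (4 * V / (1 + T)) ≤ S2 * (4 * V / (1 + V)) := mul_le_mul hS2 hTy (by positivity) hS2n
      have g3 : ψ₀ * (4 * Z / (1 + T)) ≤ 1 * (4 * Z / (1 + Z)) := mul_le_mul hψ₁ hTz (by positivity) zero_le_one
      have e : ψ₀ * (4 * (U + V + Z) / (1 + T)) = ψ₀ * (4 * U / (1 + T)) + ψ₀ * (4 * V / (1 + T)) + ψ₀ * (4 * Z / (1 + T)) := by ring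
      rw [e]; linarith
    have e2 : X / 4050 = ψ₀ * (4 * (U + V + Z) / (1 + T)) / (16200 * ℓ ^ 10) := by rw [hX]; field_simp; ring
    rw [e2]
    calc ψ₀ * (4 * (U + V + Z) / (1 + T)) / (16200 * ℓ ^ 10) ≤ ψ₀ * (4 * (U + V + Z) / (1 + T)) / (16200 * ℓ ^ 6) :=
          div_le_div_of_nonneg_left (by positivity) (by positivity) (by nlinarith)
      _ ≤ _ := div_le_div_of_nonneg_right hnum (by positivity)
  -- (B) the follower minorant: `Y∕6912 ≤ F̂`, `Y = F∕((1+T)ℓ¹⁰)`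
  set Y : ℝ := F / ((1 + T) * ℓ ^ 10) with hY
  have hY0 : 0 ≤ Y := by positivity
  have hB : Y / 6912 ≤ Fhat := by
    refine le_trans ?_ h2
    have e2 : Y / 6912 = 2 * F / (1 + T) / (13824 * ℓ ^ 10) := by rw [hY]; field_simp; ring
    rw [e2]
    refine div_le_div_of_nonneg_left (by positivity) (by positivity) ?_
    calc 2304 * ℓ ^ 6 * card ≤ 2304 * ℓ ^ 6 * (6 * ℓ ^ 4) := by gcongr
      _ = 13824 * ℓ ^ 10 := by ring
  -- (C) `W := ψ₀T∕((1+T)ℓ¹⁰) ≤ X + Y` and `ψ₀R²∕(2ℓ¹⁰) ≤ W`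
  set W : ℝ := ψ₀ * T / ((1 + T) * ℓ ^ 10) with hW
  have hWXY : W ≤ X + Y := by
    have e : W = X + ψ₀ * Y := by rw [hW, hX, hY, hT]; field_simp
    rw [e]
    nlinarith [mul_le_mul_of_nonneg_right hψ₁ hY0]
  have hWR : ψ₀ * R ^ 2 / (2 * ℓ ^ 10) ≤ W := by
    rw [hW, div_le_div_iff₀ (by positivity) (by positivity)]
    have hR2le : R ^ 2 ≤ 1 := pow_le_one₀ hR0 hR1
    have hkey : R ^ 2 * (1 + T) ≤ 2 * T := by nlinarith [mul_le_mul_of_nonneg_right hR2le hT0]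
    have := mul_le_mul_of_nonneg_left hkey (by positivity : (0 : ℝ) ≤ ψ₀ * ℓ ^ 10)
    nlinarith [this]
  have hgoal : ψ₀ / (82944 * ℓ ^ 10) * R ^ 2 ≤ ψ₀ * R ^ 2 / (2 * ℓ ^ 10) / 13824 := by
    rw [div_mul_eq_mul_div, div_div, div_le_div_iff₀ (by positivity) (by positivity)]
    nlinarith [mul_nonneg (mul_nonneg hψ₀.le (sq_nonneg R)) hℓ10.le]
  linarith [hA, hB, hWXY, hWR, hgoal]

/-- ★★ **THE UNIFORM FAR FLOOR IN THE RESCALED LETTERS** (hub `a ≠ 0`, follower signs `+`, bulk hub, `0 < ψ₀ ≤ 1`, `0 ≤ R ≤ 1`): for EVERY `p ∈ ℝ²`,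
`R ≤ ‖y‖ ⟹ ψ₀R²∕(82944L¹⁰) ≤ F̂(gnoFibreEquiv (p, gnoScale p y))` — ✓`hub_ray_minorant` ∕ ✓`follower_ray_minorant` at `s = 1`, where the transverse weight of the
rescaled letter is `4|y_x|²∕(1+|y_x|²)`, free of `x₀`. [cite: Luscher1983, §2] -/
theorem farFloor_gnoScale {a : ℍ} (ha : a ≠ 0) (ε : GnoSign L) (hε : ε.2.2 = fun _ => true) {ψ₀ : ℝ} (hψ₀ : 0 < ψ₀) (hψ₁ : ψ₀ ≤ 1)
    (hS1 : ψ₀ ≤ (2 * (‖a‖⁻¹ * a.re) * (‖a‖⁻¹ * ‖a.im‖)) ^ 2) (hS2 : ψ₀ ≤ (‖a‖⁻¹ * ‖a.im‖) ^ 2) (p : ℝ × ℝ) (y : GnoFibre L)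
    {R : ℝ} (hR0 : 0 ≤ R) (hR1 : R ≤ 1) (hfar : R ≤ ‖y‖) :
    ψ₀ / (82944 * (L : ℝ) ^ 10) * R ^ 2 ≤ gnoDeficit (fun _ => false) (fun _ => 1) a ε (gnoFibreEquiv (p, gnoScale p y)) := by
  obtain ⟨hcard0, hcard, hL1⟩ := card_fol_facts (L := L)
  -- letters and the `positivity` facts, before the minorants enter the context
  have hcx : Real.sqrt (1 + p.1 ^ 2) ^ 2 = 1 + p.1 ^ 2 := Real.sq_sqrt (by positivity)
  have hcy : Real.sqrt (1 + p.2 ^ 2) ^ 2 = 1 + p.2 ^ 2 := Real.sq_sqrt (by positivity)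
  have hU0 : 0 ≤ (gnoFibreBlocks y).1.1 0 ^ 2 + (gnoFibreBlocks y).1.1 1 ^ 2 := by positivity
  have hV0 : 0 ≤ (gnoFibreBlocks y).1.2 0 ^ 2 + (gnoFibreBlocks y).1.2 1 ^ 2 := by positivity
  have hZ0 : 0 ≤ normSq3 (gnoFibreBlocks y).2.1 := normSq3_nonneg _
  have hUVZ0 : 0 ≤ (gnoFibreBlocks y).1.1 0 ^ 2 + (gnoFibreBlocks y).1.1 1 ^ 2 + ((gnoFibreBlocks y).1.2 0 ^ 2 + (gnoFibreBlocks y).1.2 1 ^ 2) +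
      normSq3 (gnoFibreBlocks y).2.1 := by positivity
  have hT0 : 0 ≤ ‖y‖ ^ 2 := by positivity
  have hdx : (0 : ℝ) < 1 + p.1 ^ 2 + ((Real.sqrt (1 + p.1 ^ 2) * (gnoFibreBlocks y).1.1 0) ^ 2 + (Real.sqrt (1 + p.1 ^ 2) * (gnoFibreBlocks y).1.1 1) ^ 2) := by
    positivity
  have hdy : (0 : ℝ) < 1 + p.2 ^ 2 + ((Real.sqrt (1 + p.2 ^ 2) * (gnoFibreBlocks y).1.2 0) ^ 2 + (Real.sqrt (1 + p.2 ^ 2) * (gnoFibreBlocks y).1.2 1) ^ 2) := by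
    positivity
  have hdU : (0 : ℝ) < 1 + ((gnoFibreBlocks y).1.1 0 ^ 2 + (gnoFibreBlocks y).1.1 1 ^ 2) := by positivity
  have hdV : (0 : ℝ) < 1 + ((gnoFibreBlocks y).1.2 0 ^ 2 + (gnoFibreBlocks y).1.2 1 ^ 2) := by positivity
  have hden2 : (0 : ℝ) ≤ 2304 * (L : ℝ) ^ 6 * (Fintype.card (Fol L) : ℝ) := by positivity
  have ex : 4 * ((Real.sqrt (1 + p.1 ^ 2) * (gnoFibreBlocks y).1.1 0) ^ 2 + (Real.sqrt (1 + p.1 ^ 2) * (gnoFibreBlocks y).1.1 1) ^ 2) /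
        (1 + p.1 ^ 2 + ((Real.sqrt (1 + p.1 ^ 2) * (gnoFibreBlocks y).1.1 0) ^ 2 + (Real.sqrt (1 + p.1 ^ 2) * (gnoFibreBlocks y).1.1 1) ^ 2)) =
      4 * ((gnoFibreBlocks y).1.1 0 ^ 2 + (gnoFibreBlocks y).1.1 1 ^ 2) / (1 + ((gnoFibreBlocks y).1.1 0 ^ 2 + (gnoFibreBlocks y).1.1 1 ^ 2)) := by
    rw [div_eq_div_iff hdx.ne' hdU.ne', mul_pow, mul_pow, hcx]; ring
  have ey : 4 * ((Real.sqrt (1 + p.2 ^ 2) * (gnoFibreBlocks y).1.2 0) ^ 2 + (Real.sqrt (1 + p.2 ^ 2) * (gnoFibreBlocks y).1.2 1) ^ 2) /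
        (1 + p.2 ^ 2 + ((Real.sqrt (1 + p.2 ^ 2) * (gnoFibreBlocks y).1.2 0) ^ 2 + (Real.sqrt (1 + p.2 ^ 2) * (gnoFibreBlocks y).1.2 1) ^ 2)) =
      4 * ((gnoFibreBlocks y).1.2 0 ^ 2 + (gnoFibreBlocks y).1.2 1 ^ 2) / (1 + ((gnoFibreBlocks y).1.2 0 ^ 2 + (gnoFibreBlocks y).1.2 1 ^ 2)) := by
    rw [div_eq_div_iff hdy.ne' hdV.ne', mul_pow, mul_pow, hcy]; ring
  -- (no `positivity` below this line: the sum `Σ_f |η_f|²` in a hypothesis makes its hypothesis scan expensive)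
  have hFf0 : ∀ f, 0 ≤ normSq3 ((gnoFibreBlocks y).2.2 f) := fun f => normSq3_nonneg _
  have hF0 : 0 ≤ ∑ f, normSq3 ((gnoFibreBlocks y).2.2 f) := Finset.sum_nonneg fun f _ => hFf0 f
  have hnorm := norm_sq_gnoFibre y
  have hRT : R ^ 2 ≤ ‖y‖ ^ 2 := pow_le_pow_left₀ hR0 hfar 2
  have hFfT : ∀ f, normSq3 ((gnoFibreBlocks y).2.2 f) ≤ ‖y‖ ^ 2 := fun f => by
    rw [hnorm]
    have h := Finset.single_le_sum (f := fun f => normSq3 ((gnoFibreBlocks y).2.2 f)) (fun f _ => hFf0 f) (Finset.mem_univ f)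
    linarith
  have hTF : 2 * (∑ f, normSq3 ((gnoFibreBlocks y).2.2 f)) / (1 + ‖y‖ ^ 2) ≤
      ∑ f, 2 * normSq3 ((gnoFibreBlocks y).2.2 f) / (1 + normSq3 ((gnoFibreBlocks y).2.2 f)) := by
    rw [Finset.mul_sum, Finset.sum_div]
    exact Finset.sum_le_sum fun f _ => div_le_div_of_nonneg_left (by linarith [hFf0 f]) (by linarith [hFf0 f]) (by linarith [hFfT f])
  -- the two global minorants at the rescaled point (`s = 1`)
  have h1 := hub_ray_minorant (L := L) ε p.1 p.2
    (((fun j => Real.sqrt (1 + p.1 ^ 2) * (gnoFibreBlocks y).1.1 j), (fun j => Real.sqrt (1 + p.2 ^ 2) * (gnoFibreBlocks y).1.2 j)),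
      ((gnoFibreBlocks y).2.1, (gnoFibreBlocks y).2.2)) ha 1
  have h2 := follower_ray_minorant (L := L) ε p.1 p.2
    (((fun j => Real.sqrt (1 + p.1 ^ 2) * (gnoFibreBlocks y).1.1 j), (fun j => Real.sqrt (1 + p.2 ^ 2) * (gnoFibreBlocks y).1.2 j)),
      ((gnoFibreBlocks y).2.1, (gnoFibreBlocks y).2.2)) a hε 1
  dsimp only at h1 h2
  rw [← gnoFibreEquiv_gnoScale_eq_ray] at h1 h2
  simp only [one_pow, one_mul] at h1 h2
  rw [ex, ey] at h1
  have h2' := (div_le_div_of_nonneg_right hTF hden2).trans h2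
  exact far_rescaled_arith hψ₀ hψ₁ hS1 hS2 hU0 hV0 hZ0 hF0 hnorm hR0 hR1 hRT hL1 hcard0 hcard h1 h2'

end Summit.QuantumFields.YangMills.Theorems.SwapVirialDeficit.BlowUpRing

end
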